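import Summits.CriticalPhenomena.CardyFormulaZ2.Theorems.CardyBoundaryCoulombGasRectilinearCardyStubPointwiseFromEngineGPart1
import Summits.CriticalPhenomena.CardyFormulaZ2.Theorems.CardyBoundaryCoulombGasRectilinearCardyStubCounting
import Summits.CriticalPhenomena.CardyFormulaZ2.Theorems.CardyBoundaryCoulombGasRectilinearCardyStubMatching
import Summits.CriticalPhenomena.CardyFormulaZ2.Theorems.CardyBoundaryCoulombGasRectilinearCardyStubEventIdentity
import Summits.CriticalPhenomena.CardyFormulaZ2.Theorems.CardyBoundaryCoulombGasRectilinearCardyStubBoundaryFeet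
import Summits.CriticalPhenomena.CardyFormulaZ2.Theorems.CardyBoundaryCoulombGasRectilinearCardyStubRowBlocks
import Summits.CriticalPhenomena.CardyFormulaZ2.Theorems.CardyBoundaryCoulombGasBoundaryDefectGaussianRS17EventuallyRegular
import Summits.CriticalPhenomena.CardyFormulaZ2.Theorems.CardyBoundaryCoulombGasBoundaryDefectGaussianRS17ConfigsNonemptyPart14
import Summits.CriticalPhenomena.CardyFormulaZ2.Theorems.CardyBoundaryCoulombGasBoundaryDefectGaussianRStubDictionaryPositivity
import Summits.CriticalPhenomena.CardyFormulaZ2.Theorems.CardyBoundaryCoulombGasBoundaryDefectGaussianRStubRealisabilityPart4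
import Summits.CriticalPhenomena.CardyFormulaZ2.Theorems.CardyBoundaryCoulombGasBoundaryDefectGaussianRStubTransportPathsPart13
import HarnessLib

/-!
# Line `excursion-kernel-covariance` of crux `RectilinearCardy` (stmt-CriticalPhenomena-5660):
# THE LATTICE BRIDGE, proved (the glue of the line skeleton, landed)

`latticeBridge` (the registered signature of the former stub L of the skeleton, reshape c3-1, verbatim):
for a CLOCKWISE rectilinear flat-marked conformal rectangle `R`, an admissible window point `∂Ω(τ)`,
meshes `δ_n → 0⁺` and boundary-row vertices `δ_n v_n → ∂Ω(τ)`, there are placements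
`p_n → (d, ∂Ω(τ), b, a)` of the `(1,3,1,1; sink 1)` leg-insertion datum on the closure lattice polygon,
eventually injective and admissible, along which the Baxter–Kelland–Wu insertion ratio `‖Zins‖/‖Z‖` IS the
closure density `closureDensity R δ_n v_n` up to `o(δ_n)` (in fact exactly, eventually).

Everything is a landed theorem of the line or of the engine line: good placements exist at every small
mesh (`exists_goodPlacement'`: boundary feet `stub_boundaryFeet` → row blocks `stub_rowBlocks` → matching
`stub_matching`); regularity of the lattice polygons (`s17_eventually_regular`) and a height configuration
(`s17_eventually_configsNonempty`) feed the insertion dictionary (`s17_dictionary`), whose rainbow count is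
the hull count (`stub_eventIdentity`) = the density count (the matching) = `2^{|E|} ·` closure density
(`stub_counting`), while `‖Z‖ = 2^{|E|}` (`norm_Z_ofDomain`). This is the skeleton's glue
`exists_goodPlacement` + `stub_latticeBridge` (`Lines/excursion_kernel_covariance.lean` v13) moved to the
tree with the skeleton-local abbreviations (`datum`, `VZ`, `HullW`, `HullRow`, `GoodPlacement`) written out.
-/

noncomputable section

open Set Filter Metric Topology
open Literature.Probability.RandomPlanarGeometry
open Literature.Probability.LatticeModels (Site meshPoint SixVertex.edgeTip)
open Literature.Probability.LatticeModels.CollarLegModel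
open Summit.CriticalPhenomena.CardyFormulaZ2.Theorems.RectilinearCardy.Negative (IsRectilinear)
open Summit.CriticalPhenomena.CardyFormulaZ2.Cruxes.BoundaryDefectGaussianR.RainbowMonomialsInExcursionKernels

namespace Summit.CriticalPhenomena.CardyFormulaZ2.Cruxes.RectilinearCardy.ExcursionKernelCovariance

/-- `∃ x ∈ s.image f, P x ↔ ∃ y ∈ s, P (f y)`. [folklore] -/
theorem exists_mem_image_iff {α β : Type*} [DecidableEq β] (s : Finset α) (f : α → β) (P : β → Prop) :
    (∃ x ∈ s.image f, P x) ↔ ∃ y ∈ s, P (f y) := by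
  constructor
  · rintro ⟨x, hx, hP⟩
    obtain ⟨y, hy, rfl⟩ := Finset.mem_image.1 hx
    exact ⟨y, hy, hP⟩
  · rintro ⟨y, hy, hP⟩
    exact ⟨f y, Finset.mem_image_of_mem f hy, hP⟩

/-- **Good placements exist at every small mesh** (stubs W → B → M, read back through
`VZ`, `HullW`, `HullRow`). [folklore] -/
theorem exists_goodPlacement' (R : ConformalRectangle) (hR : IsRectilinear R) (hF : FlatMarks R)
    (hO : ∃ u : ℂ, (u = 1 ∨ u = Complex.I ∨ u = -1 ∨ u = -Complex.I) ∧ ∃ r : ℝ, 0 < r ∧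
        (∀ t t' : ℝ, R.mark 0 - r < t → t < t' → t' < R.mark 0 + r →
          0 < ((R.boundary t' - R.boundary t) / u).re ∧ ((R.boundary t' - R.boundary t) / u).im = 0) ∧
        (∀ z : ℂ, dist z (R.pt 0) < r → (z ∈ R.carrier ↔ 0 < -((z - R.pt 0) / u).im)))
    {σ σ' : ℝ} (hσ : AdmissibleRange R σ σ') :
    ∃ ρ : ℝ, 0 < ρ ∧ ∃ δ₁ : ℝ, 0 < δ₁ ∧ ∀ δ : ℝ, 0 < δ → δ < δ₁ →
      ∀ v ∈ boundaryRow R δ, (∃ τ ∈ Icc σ σ', dist (meshPoint δ v) (R.boundary τ) ≤ ρ) →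
        ∃ (q : Fin 4 → ℤ × ℤ) (d₀ : Dart),
          Function.Injective q ∧
          LegInsertionData.IsAdmissible (⟨(Finset.univ.erase 1).image q, fun x ↦ ∑ i ∈ (Finset.univ.erase 1).filter (fun i ↦ q i = x),
          (![1, 3, 1, 1] : Fin 4 → ℕ) i, q 1⟩ : LegInsertionData) ((closureFinset R δ).image fun x : Site 2 => (x 0, x 1)) ∧
          outDart ((closureFinset R δ).image fun x : Site 2 => (x 0, x 1)) (q 1) = some d₀ ∧
          (∀ ω : Finset ((ℤ × ℤ) × Bool), ω ⊆ inducedEdges ((closureFinset R δ).image fun x : Site 2 => (x 0, x 1)) →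
            (((∃ x : ℤ × ℤ, (∃ t ∈ (⟨(Finset.univ.erase 1).image q, fun x ↦ ∑ i ∈ (Finset.univ.erase 1).filter (fun i ↦ q i = x),
          (![1, 3, 1, 1] : Fin 4 → ℕ) i, q 1⟩ : LegInsertionData).walk ((closureFinset R δ).image fun x : Site 2 => (x 0, x 1)),
                  t.1.1 = x ∧ ((t.2.1.wired = true ∧ t.2.1.level = -1) ∨ (t.2.2.wired = true ∧ t.2.2.level = -1))) ∧
                Relation.ReflTransGen (fun b c : ℤ × ℤ ↦ ∃ e ∈ ω,
                  (e.1 = b ∧ SixVertex.edgeTip e = c) ∨ (e.1 = c ∧ SixVertex.edgeTip e = b)) (dsucc ((closureFinset R δ).image fun x : Site 2 => (x 0, x 1)) d₀).1 x) ∧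
              ¬ (∃ y : ℤ × ℤ, (∃ t ∈ (⟨(Finset.univ.erase 1).image q, fun x ↦ ∑ i ∈ (Finset.univ.erase 1).filter (fun i ↦ q i = x),
          (![1, 3, 1, 1] : Fin 4 → ℕ) i, q 1⟩ : LegInsertionData).walk ((closureFinset R δ).image fun x : Site 2 => (x 0, x 1)),
                  t.1.1 = y ∧ ((t.2.1.wired = true ∧ t.2.1.level = -3) ∨ (t.2.2.wired = true ∧ t.2.2.level = -3))) ∧
                  ∃ x : ℤ × ℤ, (∃ t ∈ (⟨(Finset.univ.erase 1).image q, fun x ↦ ∑ i ∈ (Finset.univ.erase 1).filter (fun i ↦ q i = x),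
          (![1, 3, 1, 1] : Fin 4 → ℕ) i, q 1⟩ : LegInsertionData).walk ((closureFinset R δ).image fun x : Site 2 => (x 0, x 1)),
                  t.1.1 = x ∧ ((t.2.1.wired = true ∧ t.2.1.level = -1) ∨ (t.2.2.wired = true ∧ t.2.2.level = -1))) ∧
                    Relation.ReflTransGen (fun b c : ℤ × ℤ ↦ ∃ e ∈ ω,
                  (e.1 = b ∧ SixVertex.edgeTip e = c) ∨ (e.1 = c ∧ SixVertex.edgeTip e = b)) y x)) ↔
             ((∃ x ∈ rowArc R δ, Relation.ReflTransGen (fun b c : ℤ × ℤ ↦ ∃ e ∈ ω,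
                  (e.1 = b ∧ SixVertex.edgeTip e = c) ∨ (e.1 = c ∧ SixVertex.edgeTip e = b)) (v 0, v 1) (x 0, x 1)) ∧
               ¬ (∃ y ∈ rowBeyond R δ v, ∃ x ∈ rowArc R δ, Relation.ReflTransGen (fun b c : ℤ × ℤ ↦ ∃ e ∈ ω,
                  (e.1 = b ∧ SixVertex.edgeTip e = c) ∨ (e.1 = c ∧ SixVertex.edgeTip e = b)) (y 0, y 1) (x 0, x 1))))) ∧
          (∀ i : Fin 4, ∃ dvec : ℤ × ℤ, (dvec = (1, 0) ∨ dvec = (-1, 0) ∨ dvec = (0, 1) ∨ dvec = (0, -1)) ∧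
            ∀ w : ℤ × ℤ, ((((w.1 - (q i).1) ^ 2 + (w.2 - (q i).2) ^ 2 : ℤ) : ℝ)) ≤ (ρ / δ) ^ 2 →
              (w ∈ ((closureFinset R δ).image fun x : Site 2 => (x 0, x 1)) ↔ 0 ≤ (w.1 - (q i).1) * dvec.1 + (w.2 - (q i).2) * dvec.2)) ∧
          dist (((q 1).1 : ℂ) * δ + ((q 1).2 : ℂ) * δ * Complex.I) (meshPoint δ v) ≤ δ ∧
          dist (((q 2).1 : ℂ) * δ + ((q 2).2 : ℂ) * δ * Complex.I) (R.pt 1) ≤ 4 * δ ∧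
          dist (((q 3).1 : ℂ) * δ + ((q 3).2 : ℂ) * δ * Complex.I) (R.pt 0) ≤ 4 * δ ∧
          dist (((q 0).1 : ℂ) * δ + ((q 0).2 : ℂ) * δ * Complex.I) (R.pt 3) ≤ 4 * δ := by
  obtain ⟨ρ, hρ, δ₁, hδ₁, H⟩ := stub_rowBlocks stub_boundaryFeet R hR hF hO σ σ' hσ
  refine ⟨ρ, hρ, δ₁, hδ₁, fun δ hδ hδδ₁ v hv hvτ => ?_⟩
  obtain ⟨d₀, iA, iB, iC, h1, h2, h3, h4, h5, h8, h9, h10, h11, h12, h13, hclose, hflat⟩ :=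
    H δ hδ hδδ₁ v hv hvτ ((closureFinset R δ).image fun x : Site 2 => (x 0, x 1)) (fun x => mem_image_closureFinset_iff R hδ x) (v 0, v 1) rfl
  -- feed the blocks to the matching stub with the row sets read in `ℤ × ℤ`
  set RA : Finset (ℤ × ℤ) := (rowArc R δ).image fun y : Site 2 => ((y 0, y 1) : ℤ × ℤ) with hRA
  set RB : Finset (ℤ × ℤ) := (rowBeyond R δ v).image fun y : Site 2 => ((y 0, y 1) : ℤ × ℤ) with hRB
  have hmemA : ∀ x : ℤ × ℤ, x ∈ RA ↔ ∃ y ∈ rowArc R δ, ((y 0, y 1) : ℤ × ℤ) = x := fun x => by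
    rw [hRA, Finset.mem_image]
  have hmemB : ∀ x : ℤ × ℤ, x ∈ RB ↔ ∃ y ∈ rowBeyond R δ v, ((y 0, y 1) : ℤ × ℤ) = x := fun x => by
    rw [hRB, Finset.mem_image]
  have h8' : ∀ x : ℤ × ℤ, x ∈ RA ↔ ∃ i : ℕ, iA ≤ i ∧ i ≤ iB ∧ ((dsucc ((closureFinset R δ).image fun x : Site 2 => (x 0, x 1)))^[i] d₀).1 = x ∧
      ((neighbours ((dsucc ((closureFinset R δ).image fun x : Site 2 => (x 0, x 1)))^[i] d₀).1).filter (fun y ↦ y ∉ ((closureFinset R δ).image fun x : Site 2 => (x 0, x 1)))).card = 1 := fun x => by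
    rw [hmemA]; exact h8 x
  have h9' : ∀ x : ℤ × ℤ, x ∈ RB ↔ (∃ i : ℕ, iC ≤ i ∧ i < period ((closureFinset R δ).image fun x : Site 2 => (x 0, x 1)) d₀ ∧ ((dsucc ((closureFinset R δ).image fun x : Site 2 => (x 0, x 1)))^[i] d₀).1 = x ∧
      ((neighbours ((dsucc ((closureFinset R δ).image fun x : Site 2 => (x 0, x 1)))^[i] d₀).1).filter (fun y ↦ y ∉ ((closureFinset R δ).image fun x : Site 2 => (x 0, x 1)))).card = 1) ∨ x = d₀.1 := fun x => by
    rw [hmemB]; exact h9 x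
  have h10' : ∀ i : ℕ, iA ≤ i → i ≤ iB →
      ((neighbours ((dsucc ((closureFinset R δ).image fun x : Site 2 => (x 0, x 1)))^[i] d₀).1).filter (fun y ↦ y ∉ ((closureFinset R δ).image fun x : Site 2 => (x 0, x 1)))).card ≠ 1 →
      ∀ w ∈ ((closureFinset R δ).image fun x : Site 2 => (x 0, x 1)), (w.1 - ((dsucc ((closureFinset R δ).image fun x : Site 2 => (x 0, x 1)))^[i] d₀).1.1) ^ 2 + (w.2 - ((dsucc ((closureFinset R δ).image fun x : Site 2 => (x 0, x 1)))^[i] d₀).1.2) ^ 2 = 1 →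
        w ∈ RA := fun i hi hi' hc w hw hadj => (hmemA w).2 (h10 i hi hi' hc w hw hadj)
  have h11' : ∀ i : ℕ, iC ≤ i → i < period ((closureFinset R δ).image fun x : Site 2 => (x 0, x 1)) d₀ →
      ((neighbours ((dsucc ((closureFinset R δ).image fun x : Site 2 => (x 0, x 1)))^[i] d₀).1).filter (fun y ↦ y ∉ ((closureFinset R δ).image fun x : Site 2 => (x 0, x 1)))).card ≠ 1 →
      ∀ w ∈ ((closureFinset R δ).image fun x : Site 2 => (x 0, x 1)), (w.1 - ((dsucc ((closureFinset R δ).image fun x : Site 2 => (x 0, x 1)))^[i] d₀).1.1) ^ 2 + (w.2 - ((dsucc ((closureFinset R δ).image fun x : Site 2 => (x 0, x 1)))^[i] d₀).1.2) ^ 2 = 1 →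
        w ∈ RB := fun i hi hi' hc w hw hadj => (hmemB w).2 (h11 i hi hi' hc w hw hadj)
  obtain ⟨hinj, hadm, hout, hiff⟩ := stub_matching ((closureFinset R δ).image fun x : Site 2 => (x 0, x 1)) d₀ iA iB iC (v 0, v 1) RA RB
    ⟨h1, h2, h3, h4, h5, h8', h9', h10', h11', h12, h13⟩
  refine ⟨![((dsucc ((closureFinset R δ).image fun x : Site 2 => (x 0, x 1)))^[iC] d₀).1, d₀.1, ((dsucc ((closureFinset R δ).image fun x : Site 2 => (x 0, x 1)))^[iA] d₀).1, ((dsucc ((closureFinset R δ).image fun x : Site 2 => (x 0, x 1)))^[iB] d₀).1],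
    d₀, hinj, hadm, hout, fun ω hω => ?_, fun i => ?_, ?_⟩
  · -- hull event = density event
    refine (hiff ω hω).trans ?_
    rw [hRA, hRB, exists_mem_image_iff]
    refine and_congr Iff.rfl (not_congr ?_)
    rw [exists_mem_image_iff]
    refine exists_congr fun y => and_congr Iff.rfl ?_
    rw [exists_mem_image_iff]
  · -- macroscopic flatness at each of the four points
    have hmem : (![((dsucc ((closureFinset R δ).image fun x : Site 2 => (x 0, x 1)))^[iC] d₀).1, d₀.1, ((dsucc ((closureFinset R δ).image fun x : Site 2 => (x 0, x 1)))^[iA] d₀).1,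
        ((dsucc ((closureFinset R δ).image fun x : Site 2 => (x 0, x 1)))^[iB] d₀).1] : Fin 4 → ℤ × ℤ) i ∈
        ({d₀.1, ((dsucc ((closureFinset R δ).image fun x : Site 2 => (x 0, x 1)))^[iA] d₀).1, ((dsucc ((closureFinset R δ).image fun x : Site 2 => (x 0, x 1)))^[iB] d₀).1, ((dsucc ((closureFinset R δ).image fun x : Site 2 => (x 0, x 1)))^[iC] d₀).1} :
          Finset (ℤ × ℤ)) := by
      fin_cases i <;> simp
    exact hflat _ hmem
  · simpa using hclose

/-- Squeeze: a sequence of points within `c n → 0` of a fixed point converges to it. [folklore] -/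
theorem tendsto_of_dist_le {f : ℕ → ℂ} {z : ℂ} {c : ℕ → ℝ} (hc : Tendsto c atTop (𝓝 0))
    (h : ∀ᶠ n in atTop, dist (f n) z ≤ c n) : Tendsto f atTop (𝓝 z) := by
  rw [tendsto_iff_dist_tendsto_zero]
  exact squeeze_zero' (Eventually.of_forall fun n => dist_nonneg) h hc

/-- The live edges of the collar model of any datum on `V` are the induced edges of `V`. [folklore] -/
theorem model_E (ι : LegInsertionData) (V : Finset (ℤ × ℤ)) : (ι.model V).E = inducedEdges V := rfl

/-- **Stub L — the LATTICE BRIDGE, now PROVED from the seven stubs of reshape c4-1** (registered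
signature of c3-1 kept verbatim): good placements exist eventually (stubs W, B, M); along them the
insertion ratio is EXACTLY the closure density eventually — regularity of the lattice polygons
(`s17_eventually_regular`, engine, landed) and a height configuration (stub K, second half) feed the
dictionary (stub K, first half), whose rainbow count is the hull count (stub I) = the density count
(stub M's matching) = `2^{|E|} ·` closure density (stub N), while `‖Z‖ = 2^{|E|}` (`norm_Z_ofDomain`).
[cite: BaxterKellandWu1976, §3–§4] -/
theorem latticeBridge :
    ∀ R : ConformalRectangle, IsRectilinear R → FlatMarks R →
      (∃ u : ℂ, (u = 1 ∨ u = Complex.I ∨ u = -1 ∨ u = -Complex.I) ∧ ∃ r : ℝ, 0 < r ∧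
        (∀ t t' : ℝ, R.mark 0 - r < t → t < t' → t' < R.mark 0 + r →
          0 < ((R.boundary t' - R.boundary t) / u).re ∧ ((R.boundary t' - R.boundary t) / u).im = 0) ∧
        (∀ z : ℂ, dist z (R.pt 0) < r →
          (z ∈ R.carrier ↔ 0 < -((z - R.pt 0) / u).im))) →
      ∀ σ σ' : ℝ, AdmissibleRange R σ σ' → ∀ τ ∈ Icc σ σ',
        ∀ (δ : ℕ → ℝ), (∀ n, 0 < δ n) → Tendsto δ atTop (𝓝 0) →
        ∀ (v : ℕ → Site 2), (∀ n, v n ∈ boundaryRow R (δ n)) →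
          Tendsto (fun n => meshPoint (δ n) (v n)) atTop (𝓝 (R.boundary τ)) →
          ∃ p : ℕ → Fin 4 → ℤ × ℤ,
            (∀ i : Fin 4, Tendsto (fun n => ((p n i).1 : ℂ) * δ n + ((p n i).2 : ℂ) * δ n * Complex.I)
              atTop (𝓝 ((![R.pt 3, R.boundary τ, R.pt 1, R.pt 0] : Fin 4 → ℂ) i))) ∧
            (∀ᶠ n in atTop, Function.Injective (p n) ∧
              LegInsertionData.IsAdmissible
                (⟨(Finset.univ.erase 1).image (p n),
                  fun x ↦ ∑ i ∈ (Finset.univ.erase 1).filter (fun i ↦ p n i = x),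
                    (![1, 3, 1, 1] : Fin 4 → ℕ) i, p n 1⟩ : LegInsertionData)
                ((closureFinset R (δ n)).image fun x : Site 2 => (x 0, x 1))) ∧
            ∀ ε : ℝ, 0 < ε → ∀ᶠ n in atTop,
              |‖Zins ((closureFinset R (δ n)).image fun x : Site 2 => (x 0, x 1))
                  (⟨(Finset.univ.erase 1).image (p n),
                    fun x ↦ ∑ i ∈ (Finset.univ.erase 1).filter (fun i ↦ p n i = x),
                      (![1, 3, 1, 1] : Fin 4 → ℕ) i, p n 1⟩ : LegInsertionData)‖ /
                  ‖(ofDomain ((closureFinset R (δ n)).image fun x : Site 2 => (x 0, x 1))).Z‖ -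
                closureDensity R (δ n) (v n)| ≤ ε * δ n := by
  classical
  intro R hR hF hO σ σ' hσ τ hτ δ hδ hδ0 v hv hvτ
  obtain ⟨ρ, hρ, δ₁, hδ₁, H⟩ := exists_goodPlacement' R hR hF hO hσ
  -- the placements: a good placement whenever one exists (junk otherwise, by `choose!`)
  choose! qf df hq using H
  set p : ℕ → Fin 4 → ℤ × ℤ := fun n => qf (δ n) (v n) with hp
  -- eventually the placement is good
  have hev₁ : ∀ᶠ n in atTop, δ n < δ₁ := hδ0 (Iio_mem_nhds hδ₁)
  have hev₂ : ∀ᶠ n in atTop, dist (meshPoint (δ n) (v n)) (R.boundary τ) ≤ ρ := by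
    have := (tendsto_iff_dist_tendsto_zero.1 hvτ) (Iio_mem_nhds hρ)
    filter_upwards [this] with n hn using le_of_lt hn
  have hgood := fun n (h1 : δ n < δ₁) (h2 : dist (meshPoint (δ n) (v n)) (R.boundary τ) ≤ ρ) =>
    hq (δ n) (hδ n) h1 (v n) (hv n) ⟨τ, hτ, h2⟩
  refine ⟨p, ?_, ?_, ?_⟩
  · -- convergence of the four insertion points
    have hδ4 : Tendsto (fun n => 4 * δ n) atTop (𝓝 0) := by simpa using hδ0.const_mul 4
    have hdv : Tendsto (fun n => dist (meshPoint (δ n) (v n)) (R.boundary τ)) atTop (𝓝 0) :=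
      tendsto_iff_dist_tendsto_zero.1 hvτ
    intro i
    fin_cases i
    · show Tendsto (fun n => ((p n 0).1 : ℂ) * δ n + ((p n 0).2 : ℂ) * δ n * Complex.I) atTop (𝓝 (R.pt 3))
      refine tendsto_of_dist_le hδ4 ?_
      filter_upwards [hev₁, hev₂] with n h1 h2 using (hgood n h1 h2).2.2.2.2.2.2.2.2
    · show Tendsto (fun n => ((p n 1).1 : ℂ) * δ n + ((p n 1).2 : ℂ) * δ n * Complex.I) atTop
        (𝓝 (R.boundary τ))
      have hsum : Tendsto (fun n => δ n + dist (meshPoint (δ n) (v n)) (R.boundary τ)) atTop (𝓝 0) := by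
        simpa using hδ0.add hdv
      refine tendsto_of_dist_le hsum ?_
      filter_upwards [hev₁, hev₂] with n h1 h2
      exact (dist_triangle _ (meshPoint (δ n) (v n)) _).trans (add_le_add (hgood n h1 h2).2.2.2.2.2.1 le_rfl)
    · show Tendsto (fun n => ((p n 2).1 : ℂ) * δ n + ((p n 2).2 : ℂ) * δ n * Complex.I) atTop (𝓝 (R.pt 1))
      refine tendsto_of_dist_le hδ4 ?_
      filter_upwards [hev₁, hev₂] with n h1 h2 using (hgood n h1 h2).2.2.2.2.2.2.1
    · show Tendsto (fun n => ((p n 3).1 : ℂ) * δ n + ((p n 3).2 : ℂ) * δ n * Complex.I) atTop (𝓝 (R.pt 0))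
      refine tendsto_of_dist_le hδ4 ?_
      filter_upwards [hev₁, hev₂] with n h1 h2 using (hgood n h1 h2).2.2.2.2.2.2.2.1
  · -- eventually injective and admissible
    filter_upwards [hev₁, hev₂] with n h1 h2 using ⟨(hgood n h1 h2).1, (hgood n h1 h2).2.1⟩
  · -- the insertion ratio IS the closure density, eventually
    intro ε hε
    -- the four limit points are pairwise at distance `≥ dmin > 0`
    set T : Fin 4 → ℂ := ![R.pt 3, R.boundary τ, R.pt 1, R.pt 0] with hT
    set S : Fin 4 → ℝ := ![R.mark 3, τ, R.mark 1, R.mark 0] with hS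
    have hTS : ∀ i, T i = R.boundary (S i) := by
      intro i; fin_cases i <;> rfl
    have h13 : R.mark 1 < R.mark 3 := R.strictMono_mark (show (1 : Fin 4) < 3 by decide)
    have h01 : R.mark 0 < R.mark 1 := R.strictMono_mark (show (0 : Fin 4) < 1 by decide)
    have hτ1 : R.mark 1 < τ := lt_of_lt_of_le hσ.1 hτ.1
    have hτ3 : τ < R.mark 3 := lt_of_le_of_lt hτ.2 hσ.2.2.1
    have hSmem : ∀ i, S i ∈ Ico (0 : ℝ) 1 := by
      intro i; fin_cases i
      · exact R.mark_mem 3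
      · exact ⟨(R.mark_mem 1).1.trans hτ1.le, hτ3.trans (R.mark_mem 3).2⟩
      · exact R.mark_mem 1
      · exact R.mark_mem 0
    have hSinj : ∀ i j, S i = S j → i = j := by
      intro i j h
      fin_cases i <;> fin_cases j <;> first | rfl | (exfalso; simp [hS] at h; linarith)
    have hTne : ∀ i j, i ≠ j → T i ≠ T j := by
      intro i j hij h
      rw [hTS, hTS] at h
      exact hij (hSinj i j (R.injOn_boundary (hSmem i) (hSmem j) h))
    set prs : Finset (Fin 4 × Fin 4) := Finset.univ.filter (fun ij => ij.1 ≠ ij.2) with hprs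
    have hprs_ne : prs.Nonempty := ⟨((0 : Fin 4), (1 : Fin 4)), by simp [hprs]⟩
    set dmin : ℝ := prs.inf' hprs_ne (fun ij => dist (T ij.1) (T ij.2)) with hdmin
    have hdmin_pos : 0 < dmin := by
      rw [hdmin, Finset.lt_inf'_iff]
      intro ij hij
      rw [hprs, Finset.mem_filter] at hij
      exact dist_pos.2 (hTne _ _ hij.2)
    have hdmin_le : ∀ i j, i ≠ j → dmin ≤ dist (T i) (T j) := by
      intro i j hij
      exact Finset.inf'_le (s := prs) (fun ij : Fin 4 × Fin 4 => dist (T ij.1) (T ij.2))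
        (show (i, j) ∈ prs by rw [hprs, Finset.mem_filter]; exact ⟨Finset.mem_univ _, hij⟩)
    -- the common flatness / separation radius
    set r : ℝ := min ρ (dmin / 8) with hr
    have hrpos : 0 < r := lt_min hρ (by positivity)
    have hrρ : r ≤ ρ := min_le_left _ _
    have hrd : r ≤ dmin / 8 := min_le_right _ _
    -- the engine-side eventual statements on the lattice polygons
    have hL : (![1, 3, 1, 1] : Fin 4 → ℕ) 1 = ∑ i ∈ Finset.univ.erase 1, (![1, 3, 1, 1] : Fin 4 → ℕ) i := by
      decide
    have hVmem : ∀ n, ∀ x : ℤ × ℤ, x ∈ ((closureFinset R (δ n)).image fun x : Site 2 => (x 0, x 1)) ↔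
        (((x).1 : ℂ) * ((δ n : ℝ) : ℂ) + ((x).2 : ℂ) * ((δ n : ℝ) : ℂ) * Complex.I) ∈ closure R.carrier :=
      fun n x => mem_image_closureFinset_iff R (hδ n) x
    have hreg := Summit.CriticalPhenomena.CardyFormulaZ2.Cruxes.BoundaryDefectGaussianR.RainbowMonomialsInExcursionKernels.s17_eventually_regular
      4 (![1, 3, 1, 1]) 1 hL R.toJordanDomain hR r hrpos δ hδ hδ0 (fun n => ((closureFinset R (δ n)).image fun x : Site 2 => (x 0, x 1))) hVmem
    have hne := Summit.CriticalPhenomena.CardyFormulaZ2.Cruxes.BoundaryDefectGaussianR.RainbowMonomialsInExcursionKernels.s17_eventually_configsNonempty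
      4 (![1, 3, 1, 1]) 1 hL R.toJordanDomain hR r hrpos δ hδ hδ0 (fun n => ((closureFinset R (δ n)).image fun x : Site 2 => (x 0, x 1))) hVmem
    have hev₃ : ∀ᶠ n in atTop, 4 * δ n ≤ dmin / 8 := by
      have h4 : Tendsto (fun n => 4 * δ n) atTop (𝓝 0) := by simpa using hδ0.const_mul 4
      have h4' : ∀ᶠ n in atTop, 4 * δ n < dmin / 8 := h4 (Iio_mem_nhds (by positivity : (0 : ℝ) < dmin / 8))
      exact h4'.mono fun n hn => le_of_lt hn
    have hev₄ : ∀ᶠ n in atTop, dist (meshPoint (δ n) (v n)) (R.boundary τ) ≤ dmin / 8 := by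
      have h4' : ∀ᶠ n in atTop, dist (meshPoint (δ n) (v n)) (R.boundary τ) < dmin / 8 :=
        (tendsto_iff_dist_tendsto_zero.1 hvτ) (Iio_mem_nhds (by positivity : (0 : ℝ) < dmin / 8))
      exact h4'.mono fun n hn => le_of_lt hn
    filter_upwards [hev₁, hev₂, hreg, hne, hev₃, hev₄] with n hg1 hg2 hregn hnen h₃ h₄
    obtain ⟨hinj, hadm, hout, hiff, hflat, hc1, hc2, hc3, hc0⟩ := hgood n hg1 hg2
    -- flatness at radius `r / δ n`
    have hflat_r : ∀ i' : Fin 4, ∃ dvec : ℤ × ℤ, (dvec = (1, 0) ∨ dvec = (-1, 0) ∨ dvec = (0, 1) ∨ dvec = (0, -1)) ∧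
        ∀ w : ℤ × ℤ, ((((w.1 - (p n i').1) ^ 2 + (w.2 - (p n i').2) ^ 2 : ℤ) : ℝ)) ≤ (r / δ n) ^ 2 →
          (w ∈ ((closureFinset R (δ n)).image fun x : Site 2 => (x 0, x 1)) ↔ 0 ≤ (w.1 - (p n i').1) * dvec.1 + (w.2 - (p n i').2) * dvec.2) := by
      intro i'
      obtain ⟨dvec, hdv, h⟩ := hflat i'
      refine ⟨dvec, hdv, fun w hw => h w (hw.trans ?_)⟩
      exact pow_le_pow_left₀ (div_nonneg hrpos.le (hδ n).le) (div_le_div_of_nonneg_right hrρ (hδ n).le) 2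
    -- the mesh points of the placement are within `dmin / 4` of their limits
    have hclose : ∀ i : Fin 4, dist (((p n i).1 : ℂ) * δ n + ((p n i).2 : ℂ) * δ n * Complex.I) (T i) ≤ dmin / 4 := by
      have hδn := (hδ n).le
      intro i; fin_cases i
      · show dist (((p n 0).1 : ℂ) * δ n + ((p n 0).2 : ℂ) * δ n * Complex.I) (R.pt 3) ≤ dmin / 4
        linarith
      · show dist (((p n 1).1 : ℂ) * δ n + ((p n 1).2 : ℂ) * δ n * Complex.I) (R.boundary τ) ≤ dmin / 4
        linarith [dist_triangle (((p n 1).1 : ℂ) * δ n + ((p n 1).2 : ℂ) * δ n * Complex.I)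
          (meshPoint (δ n) (v n)) (R.boundary τ)]
      · show dist (((p n 2).1 : ℂ) * δ n + ((p n 2).2 : ℂ) * δ n * Complex.I) (R.pt 1) ≤ dmin / 4
        linarith
      · show dist (((p n 3).1 : ℂ) * δ n + ((p n 3).2 : ℂ) * δ n * Complex.I) (R.pt 0) ≤ dmin / 4
        linarith
    -- hence separated by `≥ r / δ n` lattice units
    have hsep : ∀ i₁ i₂ : Fin 4, i₁ ≠ i₂ → (r / δ n) ^ 2 ≤
        ((((((p n) i₁).1 - ((p n) i₂).1) ^ 2 + (((p n) i₁).2 - ((p n) i₂).2) ^ 2 : ℤ) : ℝ)) := by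
      intro i₁ i₂ hne12
      have hd := Summit.CriticalPhenomena.CardyFormulaZ2.Cruxes.BoundaryDefectGaussianR.RainbowMonomialsInExcursionKernels.tp_mesh_dist_sq
        (δ n) (p n i₁) (p n i₂)
      have hlow : dmin / 2 ≤ dist (((p n i₁).1 : ℂ) * δ n + ((p n i₁).2 : ℂ) * δ n * Complex.I)
          (((p n i₂).1 : ℂ) * δ n + ((p n i₂).2 : ℂ) * δ n * Complex.I) := by
        have := hdmin_le i₁ i₂ hne12
        have t1 := dist_triangle (T i₁) (((p n i₁).1 : ℂ) * δ n + ((p n i₁).2 : ℂ) * δ n * Complex.I) (T i₂)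
        have t2 := dist_triangle (((p n i₁).1 : ℂ) * δ n + ((p n i₁).2 : ℂ) * δ n * Complex.I)
          (((p n i₂).1 : ℂ) * δ n + ((p n i₂).2 : ℂ) * δ n * Complex.I) (T i₂)
        have c1 := hclose i₁
        have c2 := hclose i₂
        rw [dist_comm] at c1
        linarith
      have hδpos := hδ n
      have hr2 : r ≤ dist (((p n i₁).1 : ℂ) * δ n + ((p n i₁).2 : ℂ) * δ n * Complex.I)
          (((p n i₂).1 : ℂ) * δ n + ((p n i₂).2 : ℂ) * δ n * Complex.I) := by linarith
      have hsq : r ^ 2 ≤ (δ n) ^ 2 * ((((p n i₁).1 - (p n i₂).1) ^ 2 + ((p n i₁).2 - (p n i₂).2) ^ 2 : ℤ) : ℝ) := by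
        rw [← hd]; exact pow_le_pow_left₀ hrpos.le hr2 2
      rw [div_pow, div_le_iff₀ (by positivity)]
      linarith [hsq]
    -- regularity and a height configuration, from the engine side
    obtain ⟨hflat4, hchart, hconn, hking, hkc⟩ := hregn (p n) hinj hadm hflat_r hsep
    have hcfg := hnen (p n) hinj hadm hflat_r hsep
    -- the dictionary
    have hdict := BoundaryDefectGaussianR.RainbowMonomialsInExcursionKernels.s17_dictionary (⟨(Finset.univ.erase 1).image (p n), fun x ↦ ∑ i ∈ (Finset.univ.erase 1).filter (fun i ↦ p n i = x),
        (![1, 3, 1, 1] : Fin 4 → ℕ) i, p n 1⟩ : LegInsertionData) ((closureFinset R (δ n)).image fun x : Site 2 => (x 0, x 1))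
      hadm hflat4 hchart hconn hking hkc hcfg
    -- rainbow count = density count, and the ratio is the density
    have hcount := stub_counting R (δ n) (v n) (hδ n) (hv n)
    have hZ := Summit.CriticalPhenomena.CardyFormulaZ2.Cruxes.BoundaryDefectGaussianR.RainbowMonomialsInExcursionKernels.norm_Z_ofDomain
      hking
    have hsub : ‖Zins ((closureFinset R (δ n)).image fun x : Site 2 => (x 0, x 1)) (⟨(Finset.univ.erase 1).image (p n), fun x ↦ ∑ i ∈ (Finset.univ.erase 1).filter (fun i ↦ p n i = x),
        (![1, 3, 1, 1] : Fin 4 → ℕ) i, p n 1⟩ : LegInsertionData)‖ / ‖(ofDomain ((closureFinset R (δ n)).image fun x : Site 2 => (x 0, x 1))).Z‖ - closureDensity R (δ n) (v n) = 0 := by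
      rw [hdict, hZ, hcount, model_E, div_eq_inv_mul, sub_eq_zero]
      refine congrArg₂ (· * ·) rfl ?_
      refine congrArg (fun s : Finset (Finset ((ℤ × ℤ) × Bool)) => ((s.card : ℕ) : ℝ)) ?_
      refine Finset.filter_congr fun ω hω => ?_
      have hωE : ω ⊆ inducedEdges ((closureFinset R (δ n)).image fun x : Site 2 => (x 0, x 1)) := Finset.mem_powerset.1 hω
      exact (stub_eventIdentity ((closureFinset R (δ n)).image fun x : Site 2 => (x 0, x 1)) (p n) hinj hadm hflat4 hchart hconn hking hkc
        (df (δ n) (v n)) hout ω hωE).trans (hiff ω hωE)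
    show |‖Zins ((closureFinset R (δ n)).image fun x : Site 2 => (x 0, x 1)) (⟨(Finset.univ.erase 1).image (p n), fun x ↦ ∑ i ∈ (Finset.univ.erase 1).filter (fun i ↦ p n i = x),
        (![1, 3, 1, 1] : Fin 4 → ℕ) i, p n 1⟩ : LegInsertionData)‖ / ‖(ofDomain ((closureFinset R (δ n)).image fun x : Site 2 => (x 0, x 1))).Z‖ - closureDensity R (δ n) (v n)| ≤ ε * δ n
    rw [hsub, abs_zero]
    have := hδ n
    positivity


end Summit.CriticalPhenomena.CardyFormulaZ2.Cruxes.RectilinearCardy.ExcursionKernelCovariance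

end
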